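/-
Copyright (c) 2026. All rights reserved.
Released under Apache 2.0 license as described in the file LICENSE.
Authors: abc-iut cell, seat abc-iut-L4-t9 (gen 4; block W2-B2, [AbsTopIII] Cor 3.7 at the `P`-sub-models).
-/
import Literature.AnabelianGeometry.AbsoluteAnabelian.AbsTopIII.BiAnabelianModelSlim
import HarnessLib

/-!
# [AbsTopIII] Corollary 3.7 (i)–(v) at the model restricted to ANY "strictly-Belyi-type-like" object
# property `P` (slim `Π_k`), modulo the lift datum `θ^bi` only — proof-only, `P`-parametrised

S. Mochizuki, *Topics in absolute anabelian geometry III* [MochizukiAbsTopIII2015] (kurims manuscript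
`paper:url-5493eb38cbb7`), Cor 3.7 pp. 86–89 for `𝒳 = 𝒞^{MLF-sB}_{T𝔽}`: the FULL SUBCATEGORY of
`𝒞^{MLF}_{T𝔽}` on the pairs "of strictly Belyi type" (Def 3.1 (ii)/(iii) pp. 67–68).  The tree has no
étale `π₁` (plan/FOUNDATIONS row 12), so "of strictly Belyi type" is carried as an ABSTRACT object
property `P` of the model category `TFModel p` together with its one printed consequence used here,
`hP : P A → IsSlimGroup A.pair.Pi` ([AbsTopI] Prop 2.3 (ii)) — the same parametrisation as
abc-iut-L4-t5's Cor 3.6 model (`FrobeniusPictureMLFModel.lean`).  `TFModel.modelSettingSlim p`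
(`BiAnabelianModelSlim.lean`) is the special case `P = (slim Π_k)`.

PROOF-ONLY (no declarations of notions): for every `P`, `hP`, every object `x₀` with `P x₀` (non-vacuity
witness of the sub-model) and every bi-anabelian lift datum `θ` over the `P`-sub-model,

* `TFModel.model_of_logKernelObstruction` — Lemma 3.4 for `(modelSetting p).restrict P` (gen 3's
  separation `iotaLogMap_ne_timesToPf_prime` holds at EVERY object);
* `TFModel.model_of_cor_3_7` — Cor 3.7 (i)–(v) for `(modelSetting p).restrict P` (w5-d210's
  `cor_3_7_of_inputs` with `hobs` from the previous item and `hX := isIdRigid_fullSubcategory_of_slim P hP`).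

HONEST FRAMING: "for every `θ`" — at `P = ⊤` and `P =` slim the `θ`-type is EMPTY
(`BiAnabelianModelLiftVacuity.lean`); at the intended `P` = strictly Belyi type, `θ^bi` is Cor 1.10
(campaign-L base), not constructed in the tree.  Nothing here bears on [IUTchIII] Cor. 3.12.
-/

set_option autoImplicit false

namespace Literature.AnabelianGeometry.AbsoluteAnabelian.AbsTopIII

open CategoryTheory
open Literature.AlgebraicGeometry.Frobenioids (IsSlimGroup)

namespace TFModel

variable (p : ℕ) [hp : Fact p.Prime] (P : ObjectProperty (TFModel p))

/-- **Lemma 3.4 for the `P`-sub-model**, at any object `x₀` with `P x₀`: for every morphism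
`a : x₀ → log x₀ = x₀`, `(λ^×(a) ≫ ι_log)(p) ∈ (𝒪^×_k̄)^pf ∌ [p] = ι_×(p)`.
[cite: MochizukiAbsTopIII2015, Lemma 3.4 p.74] -/
theorem model_of_logKernelObstruction (x₀ : TFModel p) (hx₀ : P x₀) :
    Literature.AnabelianGeometry.AbsoluteAnabelian.AbsTopIII.BiAnabelianSetting.LogKernelObstruction
      ((modelSetting p).restrict P fun _ h => h) := by
  refine (modelSetting p).logKernelObstruction_restrict P _ x₀ hx₀ fun a _ h => ?_
  have h1 : ((modelSetting p).lamTimes.map a ≫ (modelSetting p).iotaLog.app x₀).homM (primeTimes p) =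
      ((modelSetting p).iotaTimes.app x₀).homM (primeTimes p) := by
    rw [h]
  exact iotaLogMap_ne_timesToPf_prime (unitsGal (Hom.galois (a : Hom x₀ x₀)) (primeTimes p)) h1

/-- **[AbsTopIII] Cor 3.7 (i)–(v) for the `P`-sub-model of the model, modulo `θ^bi` only**, for every
object property `P` whose objects have slim `Π_k` (print: `P` = "of strictly Belyi type" ⇒ slim by
[AbsTopI] Prop 2.3 (ii)), every `P`-object `x₀` and every bi-anabelian lift datum `θ` over the
sub-model: abc-iut-w5-d210's `cor_3_7_of_inputs` with BOTH residual model inputs discharged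
(`hobs` = Lemma 3.4 at `x₀`, `hX` = `isIdRigid_fullSubcategory_of_slim P hP`).
[cite: MochizukiAbsTopIII2015, Cor 3.7 pp.86–89] -/
theorem model_of_cor_3_7 (hP : ∀ A : TFModel p, P A → IsSlimGroup A.pair.Pi) (x₀ : TFModel p)
    (hx₀ : P x₀) (θ : FiberSquare.BiAnabelianLift ((modelSetting p).restrict P fun _ h => h).gal) :
    ((modelSetting p).restrict P fun _ h => h).Cor_3_7_i ∧
      ((modelSetting p).restrict P fun _ h => h).Cor_3_7_ii θ ∧
      Literature.AnabelianGeometry.AbsoluteAnabelian.AbsTopIII.BiAnabelianSetting.Cor_3_7_iii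
        ((modelSetting p).restrict P fun _ h => h) ∧
      ((modelSetting p).restrict P fun _ h => h).Cor_3_7_iv θ ∧
      ((modelSetting p).restrict P fun _ h => h).Cor_3_7_v :=
  ((modelSetting p).restrict P fun _ h => h).cor_3_7_of_inputs θ
    (model_of_logKernelObstruction p P x₀ hx₀) (isIdRigid_fullSubcategory_of_slim P hP)

/-- The slim sub-model is the case `P = (slim Π_k)`: `modelSettingSlim p` IS `(modelSetting p).restrict _`
(definitionally). [cite: MochizukiAbsTopIII2015, Cor 3.7 p.86] -/
theorem modelSettingSlim_eq_restrict :
    modelSettingSlim p = (modelSetting p).restrict (fun A : TFModel p => IsSlimGroup A.pair.Pi) fun _ h => h :=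
  rfl

end TFModel

end Literature.AnabelianGeometry.AbsoluteAnabelian.AbsTopIII
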